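import Summits.BirchSwinnertonDyer.BirchSwinnertonDyer.Theorems.SignedLowerHalvesSprungLowerHalfAtThreeFWLocus
import Literature.NumberTheory.EllipticCurves.CastellaCiperianiSkinnerSprung2018.NonordinaryPPartOPEN
import HarnessLib

/-!
# Route `SignedLowerHalves`, crux `SprungLowerHalfAtThree` (item stmt-BirchSwinnertonDyer-19003): clause (B)
# (`stub_chromaticDivisibility`) on X8 ∩ {SEMISTABLE} ∩ {r_an ≤ 1}, CLOSED MODULO the ONE existing OPEN
# binder `CastellaCiperianiSkinnerSprung2018.thmCD_pPart_OPEN` (CCSS Thm. C in print shape), and the UNION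
# with the Fouquet–Wan locus (cell `bsd-ssimc`, seat `bsd-ssimc-k3-c5` gen 2; a `--supports … --as helper`
# file, closes nothing)

PARTITION (cell bsd-ssimc): X8 (A8) ∩ {semistable} — census from the planner's table
`bsd-ssimc-plan/census/fw_x8.tsv` (217 X8 cells of conductor < 5·10⁵, all at `p = 3`, `a_3 = ±3`):
49 semistable cells (rank 0: 28, rank 1: 21 — all of surjective mod-3 image, as they must be:
`ClassX8.surj_of_semistable`, Serre 1972 Prop. 21); together with the Fouquet–Wan locus of the companion
file (121 cells) the two PRE binders reach 127 of 217 cells, and 71 of the 82 cells on the leaf's branch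
`r_an = 0 ∧ surj` (the remaining 11 — 7744n1, 9251d1, 11123a1, 12584l1, 15152a1, 17200bj1, 17986l1,
18515u1, 18656b1, 19600eb1, 159536bd1 — are non-semistable with only split or 3-unramified non-split
multiplicative primes, or none: no engine even claimed) — types-the-object-of; closes NONE. THEOREMS ONLY;
nothing booked; both binders are UNREFEREED claims carried by name.

Companion of `SignedLowerHalvesSprungLowerHalfAtThreeChromaticReduction.lean` (p417882: clause (B) of crux 5
is Λ-free — at `r_an = 0` it is `MissingLowerBoundAt W 3`, off corank `0` it is vacuous) and of
`SignedLowerHalvesSprungLowerHalfAtThreeFWLocus.lean` (p418174: (B) on the FW locus modulo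
`FouquetWan2021.cor54_pPart_rankZero_OPEN`). The cell's Literature binder file
`CastellaCiperianiSkinnerSprung2018/NonordinaryPPartOPEN.lean` (b2b harvest seat) types Castella–Çiperiani–
Skinner–Sprung arXiv:1804.10993v2 Thms. C/D as ONE OPEN `Prop` `thmCD_pPart_OPEN` — semistable `E`, odd good
supersingular `p`, `E[p]` irreducible, BOTH ranks — and proves the conditional class theorem
`X8.bsdp_of_thmCD_OPEN'` (no (irr) binder: Serre Prop. 12). FIRST-HAND READING by this seat (2026-08-26, held
text `paper:arxiv-1804.10993` p. 3–5, 24): §1.1 standing hypothesis «Let `p > 2` be a prime … `p ∤ N`, and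
non-ordinary in the sense that `|ı_p(a_p)|_p < 1`» — so at `p = 3` the case `a_3 = ±3` IS admitted (Rem. 1.2:
«Theorem A was first established by Xin Wan [wan-combined] when `a_p = 0` and by Sprung [sprung-IMC] when
`p ∣ a_p` but `a_p ≠ 0`»); Thm. C verbatim: «Let `A/ℚ` be a semistable abelian variety of GL₂-type of
conductor `N` … let `p ∤ N` be a prime of good reduction for `A`, and assume that `A` has no rational
isogenies of `p`-power degree. If `L(A,1) ≠ 0`, then … `ord_𝔓(L(A,1)/Ω_A) = ord_𝔓(#Ш(A/ℚ) ∏_{ℓ∣N}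
c_ℓ(A/ℚ))`»; its printed proof (p. 24): Thm. A (square-free `N`) + the interpolation property of
`L_p^∙(f)` [LLZ-AJM] + «a variant of [greenberg-cetraro] for signed Selmer groups (see [sprung-IMC])» +
Ribet's level lowering (ramified prime). EXPOSURE (why OPEN, not a fact): Thm. A ⇐ Thm. B (definite case) ⇐
the Greenberg–Iwasawa main-conjecture divisibility of [wan-combined] = Wan arXiv:1411.6352, WITHDRAWN
(Burungale–Skinner–Tian–Wan 2024 Rem. 1.4 (i)); and [sprung-IMC], cited there as a theorem, appeared as
Sprung, Adv. Math. 449 (2024) CONDITIONAL on its Conjecture 3.33. So for the rank-0 clause used here the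
binder is logically the SAME open statement as «Sprung 2024 Cor. 1.2 (first sentence) granted Conj. 3.33»;
one typed binder serves both printed sources (no near-duplicate `Prop` minted, TYPER LINT).

Composition (as in the FW file): on X8 ∩ {semistable}, `Sel_{3^∞}(E/ℚ)` infinite ⇒ (B) trivially; finite ⇒
Mordell–Weil rank `0` (corank identity) ⇒ `r_an = 0` (GZK, `r_an ≤ 1`) ⇒ `BSD(E,3)` from the binder
(`X8.bsdp_of_thmCD_OPEN'`, which needs NO modularity/period input: CCSS print `Ω_A` = the Néron period) ⇒
`MissingLowerBoundAt W 3` ⇒ (B) by `chromaticDatum_of_missingLowerBoundAt` (colour `♭`; `|ϖ|_3 = 1` from the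
period fact). A-KATO-3 does not arise on this locus: semistable X8 curves have surjective `ρ̄_{E,3}` and
`SL₂(ℤ_3) ⊆ ρ_{E,3^∞}(G_{ℚ(ζ_{3^∞})})` by the tree theorems `ClassX8.surj_of_semistable`,
`ClassX8.imageContainsSL2_of_semistable` (Wuthrich 2014 Lemma 20) — recorded, not used.

References: [CastellaCiperianiSkinnerSprung2018] §1.1, Thm. A, Thm. C, Rem. 1.2, proof of Thm. C (p. 24)
(PRE); [Sprung2024] Thm. 1.1, Cor. 1.2; [FouquetWan2021] Thm. 5.1 / Cor. 5.4 (PRE); [Sprung2017] Cor. 4.11;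
[Serre1972] Prop. 12, Prop. 21; [Wuthrich2014] Lemma 20; [GreenbergLNM1716] §1; [Miller2011LMS] Def. 1.1.
-/

set_option autoImplicit false
set_option linter.dupNamespace false

noncomputable section

open scoped Classical MatrixGroups ModularForm

open CongruenceSubgroup WeierstrassCurve Literature.NumberTheory.EllipticCurves
  Literature.NumberTheory.EllipticCurves.ModularForms
  Literature.NumberTheory.EllipticCurves.Rank1Residual
  Literature.NumberTheory.EllipticCurves.Rank1Residual.Typed
  Literature.NumberTheory.EllipticCurves.Sprung2017
  Literature.NumberTheory.EllipticCurves.CastellaCiperianiSkinnerSprung2018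
  Summit.BirchSwinnertonDyer.Rank1Residual.Supersingular

namespace Summit.BirchSwinnertonDyer.BirchSwinnertonDyer.Theorems

/-- **X8 ∩ {semistable}, analytic rank ≤ 1: the Λ-free lower bound MODULO the CCSS binder.** For a globally
minimal SEMISTABLE `W` on class X8 (`p = 3`, good supersingular, `a_3 = ±3`) with `ord_{s=1} L(E,s) = 0`: IF
the announced Thms. C/D of Castella–Çiperiani–Skinner–Sprung hold (`hCCSS_OPEN`, UNREFEREED; at `p = 3` the
print admits `a_3 = ±3`), then `ord_3 #Ш_an ≤ ord_3 #Ш` (`MissingLowerBoundAt W 3`) — indeed the whole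
`BSD(E,3)` (`X8.bsdp_of_thmCD_OPEN'`, GZK `hGZK`; `E[3]` irreducible by Serre Prop. 12). CONDITIONAL;
closes nothing. [claim: CastellaCiperianiSkinnerSprung2018, status: under-review]
[cite: Serre1972, §1.11 Prop. 12] [cite: Miller2011LMS, Def. 1.1] -/
theorem X8_missingLowerBoundAt_semistable_of_thmCD_OPEN_of_analyticRank_eq_zero
    (hCCSS_OPEN : thmCD_pPart_OPEN) (hGZK : rank_eq_analyticRank_of_analyticRank_le_one)
    (W : WeierstrassCurve ℚ) [W.IsElliptic] [W.IsGloballyMinimal] (p : ℕ) [Fact p.Prime]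
    (hX : ClassX8 W p) (hsst : Semistable W) (hr0 : W.analyticRank = 0) :
    MissingLowerBoundAt W p := by
  have hr : W.analyticRank ≤ 1 := by omega
  haveI : Finite W.sha := (hGZK W hr).2
  have hBSD : BSDp W p := X8.bsdp_of_thmCD_OPEN' hCCSS_OPEN hGZK W p hX hsst hr
  exact (lower_and_upper_of_missingPPartAt W p (missingPPartAt_of_bsdp W p hBSD)).1

/-- **X8 ∩ {semistable}, analytic rank ≤ 1: `stub_chromaticDivisibility` MODULO the ONE OPEN binder
`CastellaCiperianiSkinnerSprung2018.thmCD_pPart_OPEN`.** For a globally minimal SEMISTABLE `W` on class X8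
(`p = 3`, good supersingular, `a_3 = ±3`) with `ord_{s=1} L(E,s) ≤ 1`: IF the announced CCSS Thms. C/D
hold (`hCCSS_OPEN`, UNREFEREED — first-hand: §1.1 «`p > 2` … `p ∤ N`, `|ı_p(a_p)|_p < 1`», Thm. C
«semistable … no rational isogenies of `p`-power degree … `L(A,1) ≠ 0`»; `a_3 = ±3` admitted, Rem. 1.2),
then for ANY newform `f` of `W`, its period ratio `ϖ` and ANY Sprung pair, clause (B) of crux 5 holds
(colour `♭`). Cases: `Sel_{3^∞}(E/ℚ)` infinite ⇒ trivial witness (`chromaticDatum_of_not_finite_selmer`);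
finite ⇒ Mordell–Weil rank `0` (corank identity, `mordellWeilRank_eq_zero_of_finite_selmerGroupPInfty`) ⇒
`r_an = 0` (GZK) ⇒ `MissingLowerBoundAt W 3` (previous theorem) ⇒ (B) by
`chromaticDatum_of_missingLowerBoundAt` (needs `L(E,1) ≠ 0` from `hasEntireLFunction_rat` and
`|ϖ|_3 ≤ 1` from the period fact `h3`). Unlike the FW-locus companion, NO modularity binder is needed
(CCSS print the Néron period). A-KATO-3 is void here (`ClassX8.imageContainsSL2_of_semistable`, unused).
CONDITIONAL; closes nothing; nothing booked. [claim: CastellaCiperianiSkinnerSprung2018, status: under-review]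
[cite: Sprung2017, Cor. 4.11 (table of special values)] [cite: GreenbergVatsal2000, §3 Remark 3.4]
[cite: GreenbergLNM1716, §1 p. 54] [cite: Miller2011LMS, Def. 1.1] -/
theorem X8_chromaticDivisibility_semistable_of_thmCD_OPEN_of_analyticRank_le_one
    (hCCSS_OPEN : thmCD_pPart_OPEN) (hGZK : rank_eq_analyticRank_of_analyticRank_le_one)
    (hmod : hasEntireLFunction_rat) (h3 : realPeriodRat_eq_unit_mul_plusPeriod_three)
    (W : WeierstrassCurve ℚ) [W.IsElliptic] [W.IsGloballyMinimal] (p : ℕ) [Fact p.Prime]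
    (hX : ClassX8 W p) (hsst : Semistable W) (hr : W.analyticRank ≤ 1)
    {N : ℕ} [NeZero N] {f : CuspForm (Gamma0 N) 2} (hf : IsNewformOf W f)
    {ϖ : ℚ} (hϖ : (ϖ : ℝ) * W.realPeriodRat = plusPeriod f)
    {Lsharp Lflat : IwasawaAlgebra p} (hSP : IsSprungPair f p (W.frobeniusTrace p) Lsharp Lflat) :
    ∃ (c : Chroma) (ξ : IwasawaAlgebra p), (⟨ξ, 0, 0⟩ : SignedDatum W p).EulerCharacteristic ∧
      ∃ h : IwasawaAlgebra p, iwasawaToPowerSeries p ξ =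
        PowerSeries.C (ϖ : ℚ_[p]) * iwasawaToPowerSeries p (chromaticL c Lsharp Lflat * h) := by
  have hp3 : p = 3 := hX.1
  subst hp3
  by_cases hfin : Finite (W.selmerGroupPInfty 3)
  · have hrk : W.mordellWeilRank = 0 := mordellWeilRank_eq_zero_of_finite_selmerGroupPInfty W 3 hfin
    have hr0 : W.analyticRank = 0 := by
      have h := (hGZK W hr).1
      omega
    have hlow : MissingLowerBoundAt W 3 :=
      X8_missingLowerBoundAt_semistable_of_thmCD_OPEN_of_analyticRank_eq_zero hCCSS_OPEN hGZK W 3 hX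
        hsst hr0
    have hL : W.entireLFunction 1 ≠ 0 := (W.analyticRank_eq_zero_iff_holds (hmod W)).1 hr0
    have hϖ1 : ‖(ϖ : ℚ_[3])‖ ≤ 1 := (X8_norm_periodRatio_eq_one h3 W 3 hX hf hϖ).le
    obtain ⟨ξ, hK, hdiv⟩ := chromaticDatum_of_missingLowerBoundAt W 3 hGZK (by decide) hX.2.1.1
      (ClassX8.irr W 3 hX) hL hf hϖ hϖ1 hSP .flat (ClassX8.not_dvd_chromaticConst' W 3 hX .flat) hlow
    exact ⟨.flat, ξ, hK, hdiv⟩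
  · obtain ⟨ξ, hK, hdiv⟩ := chromaticDatum_of_not_finite_selmer W 3 hfin ϖ (chromaticL .flat Lsharp Lflat)
    exact ⟨.flat, ξ, hK, hdiv⟩

/-- **The same in the registered stub's binder order** (`stub_chromaticDivisibility` restricted to
SEMISTABLE X8 curves and analytic rank ≤ 1, the leaf's regime), MODULO the one OPEN binder
`thmCD_pPart_OPEN` and the published facts GZK, `hasEntireLFunction_rat`, and the period-ratio unit at `3`.
What it buys on X8: the 28 rank-0 semistable cells of board A8 (conductor < 5·10⁵; all of surjective image)
would read «PRE-claimed (CCSS Thm. C at `p = 3`, `a_3 = ±3`)» for crux 5's clause (B); 3 of them (ranks 0)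
lie OFF the Fouquet–Wan locus of the companion file; rank-1 cells are trivial for (B) as typed. Class-wide:
every semistable `E/ℚ` with good supersingular `3` and `a_3 = ±3`. CONDITIONAL; closes nothing.
[claim: CastellaCiperianiSkinnerSprung2018, status: under-review] [cite: Miller2011LMS, Def. 1.1] -/
theorem stub_chromaticDivisibility_semistable_of_thmCD_OPEN
    (hCCSS_OPEN : thmCD_pPart_OPEN) (hGZK : rank_eq_analyticRank_of_analyticRank_le_one)
    (hmod : hasEntireLFunction_rat) (h3 : realPeriodRat_eq_unit_mul_plusPeriod_three) :
    ∀ (W : WeierstrassCurve ℚ) [W.IsElliptic] [W.IsGloballyMinimal] (p : ℕ) [Fact p.Prime],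
      Literature.NumberTheory.EllipticCurves.Rank1Residual.ClassX8 W p →
      Literature.NumberTheory.EllipticCurves.Rank1Residual.Semistable W →
      W.analyticRank ≤ 1 →
      ∀ (N : ℕ) (_ : NeZero N) (f : CuspForm (CongruenceSubgroup.Gamma0 N) 2) (ϖ : ℚ)
        (Lsharp Lflat : Literature.NumberTheory.EllipticCurves.IwasawaAlgebra p),
        Literature.NumberTheory.EllipticCurves.ModularForms.IsNewformOf W f →
        (ϖ : ℝ) * W.realPeriodRat = Literature.NumberTheory.EllipticCurves.ModularForms.plusPeriod f →
        Literature.NumberTheory.EllipticCurves.Sprung2017.IsSprungPair f p (W.frobeniusTrace p)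
          Lsharp Lflat →
        ∃ (c : Literature.NumberTheory.EllipticCurves.Sprung2017.Chroma)
          (ξ : Literature.NumberTheory.EllipticCurves.IwasawaAlgebra p),
          (⟨ξ, 0, 0⟩ : Summit.BirchSwinnertonDyer.Rank1Residual.Supersingular.SignedDatum W p).EulerCharacteristic ∧
          ∃ h : Literature.NumberTheory.EllipticCurves.IwasawaAlgebra p,
            Literature.NumberTheory.EllipticCurves.iwasawaToPowerSeries p ξ =
              PowerSeries.C (ϖ : ℚ_[p]) *
                Literature.NumberTheory.EllipticCurves.iwasawaToPowerSeries p
                  (Literature.NumberTheory.EllipticCurves.Sprung2017.chromaticL c Lsharp Lflat * h) := by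
  intro W _ _ p _ hX hsst hr N hN f ϖ Lsharp Lflat hf hϖ hSP
  exact X8_chromaticDivisibility_semistable_of_thmCD_OPEN_of_analyticRank_le_one hCCSS_OPEN hGZK hmod h3
    W p hX hsst hr hf hϖ hSP

/-- **UNION of the two PRE-claimed loci: X8 ∩ ({semistable} ∪ Fouquet–Wan locus), analytic rank ≤ 1 —
clause (B) MODULO the TWO existing OPEN binders** `CastellaCiperianiSkinnerSprung2018.thmCD_pPart_OPEN`
(semistable branch; no modularity input) and `FouquetWan2021.cor54_pPart_rankZero_OPEN` (FW branch, with
modularity `hnf` and the period facts `h5`/`h3` as in the companion file), plus GZK, `hasEntireLFunction_rat`.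
Census (planner table fw_x8.tsv): the union reaches 127 of the 217 X8 cells of conductor < 5·10⁵
(FW 121 + 6 semistable cells off the FW locus), 71 of the 82 cells on the leaf's branch `r_an = 0 ∧ surj`;
the 11 remaining rank-0 large-image cells carry no claimed engine (non-semistable; multiplicative primes all
split or with `E[3]` unramified, or none), and the 60 rank-0 small-image (3Nn) cells are the route's residual
item. CONDITIONAL; closes nothing; nothing booked. [claim: CastellaCiperianiSkinnerSprung2018, status: under-review]
[claim: FouquetWan2021, status: under-review] [cite: Miller2011LMS, Def. 1.1] -/
theorem X8_chromaticDivisibility_semistable_or_fwLocus_of_OPEN_of_analyticRank_le_one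
    (hCCSS_OPEN : thmCD_pPart_OPEN) (hFW_OPEN : FouquetWan2021.cor54_pPart_rankZero_OPEN)
    (hnf : exists_isNewformOf) (hGZK : rank_eq_analyticRank_of_analyticRank_le_one)
    (hmod : hasEntireLFunction_rat)
    (h5 : realPeriodRat_eq_unit_mul_plusPeriod) (h3 : realPeriodRat_eq_unit_mul_plusPeriod_three)
    (W : WeierstrassCurve ℚ) [W.IsElliptic] [W.IsGloballyMinimal] (p : ℕ) [Fact p.Prime]
    (hX : ClassX8 W p)
    (hloc : Semistable W ∨
      ∃ (ℓ : ℕ) (_ : Fact ℓ.Prime), ℓ ≠ p ∧ W.HasMultiplicativeReductionAtPrime ℓ ∧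
        ¬ W.HasSplitMultiplicativeReductionAtPrime ℓ ∧ ¬ p ∣ padicValInt ℓ W.minimalDiscriminantInt)
    (hr : W.analyticRank ≤ 1)
    {N : ℕ} [NeZero N] {f : CuspForm (Gamma0 N) 2} (hf : IsNewformOf W f)
    {ϖ : ℚ} (hϖ : (ϖ : ℝ) * W.realPeriodRat = plusPeriod f)
    {Lsharp Lflat : IwasawaAlgebra p} (hSP : IsSprungPair f p (W.frobeniusTrace p) Lsharp Lflat) :
    ∃ (c : Chroma) (ξ : IwasawaAlgebra p), (⟨ξ, 0, 0⟩ : SignedDatum W p).EulerCharacteristic ∧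
      ∃ h : IwasawaAlgebra p, iwasawaToPowerSeries p ξ =
        PowerSeries.C (ϖ : ℚ_[p]) * iwasawaToPowerSeries p (chromaticL c Lsharp Lflat * h) := by
  rcases hloc with hsst | hFW
  · exact X8_chromaticDivisibility_semistable_of_thmCD_OPEN_of_analyticRank_le_one hCCSS_OPEN hGZK hmod h3
      W p hX hsst hr hf hϖ hSP
  · exact X8_chromaticDivisibility_fwLocus_of_cor54_OPEN_of_analyticRank_le_one hFW_OPEN hnf hGZK hmod h5
      h3 W p hX hFW hr hf hϖ hSP

end Summit.BirchSwinnertonDyer.BirchSwinnertonDyer.Theorems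

end
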